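import Mathlib
import HarnessLib
import Summits.Ventures.LatticeQCDFlow.Exactness.SphereLuscherSeriesLocalityES

/-!
# Lattice symmetries of Lüscher's flow-action series on the site spheres: each order is invariant up to constants, and the local terms can be taken as translates of one polynomial (weight sharing)

HONEST FRAMING: exact (Metropolis-corrected) sampling algorithms for lattice gauge theory;
figures of merit are autocorrelation/cost numbers at stated couplings and volumes; no
continuum-physics claim.

Venture `LatticeQCDFlow` (cell pub-lqcd), topic `Exactness`; FANOUT row 7 (`s0-cpn-null`).  NEW
WORK of the cell over Mathlib (`Function.update_comp_equiv`, `Equiv.sum_comp`) and the tree's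
`Exactness/SphereLuscherSeriesUniqueness.lean` (`luscher_series_unique`),
`Exactness/SphereLuscherSeriesLocality.lean` (`nball`, `polySD`, `neg_sum_siteLaplacian_sum`,
`siteGrad_sum`), `Exactness/SphereLuscherSeriesExistence.lean` (`latticeCarre`) and
`Exactness/SphereLOFlowAction.lean` (`siteGrad`, `siteLaplacian`); nothing is cited as a fact.
Printed counterpart, NAMED ONLY: M. Lüscher, Commun. Math. Phys. 293 (2010) 899, §4.4 (the flow
action of each order is a sum over lattice points of translates of the same local composite field);
gauge-equivariant / translation-equivariant flow architectures share their weights across sites for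
exactly this reason (Kanwar et al. 2020, Albergo et al. 2019 — named only, nothing used).

## Content (`E` finite-dimensional real inner product space, `dim E ≥ 2`; `Λ` finite; `σ : Λ ≃ Λ`)

* `relabel σ F = F ∘ (· ∘ σ)` — a functional read through a relabelling of the sites;
  **`siteGrad_relabel`**, **`siteLaplacian_relabel`** (`∂̃_k (F∘σ*) (x) = ∂̃_{σ⁻¹k} F (x∘σ)`, and the
  same for `∂̃_k·∂̃_k` — `Function.update_comp_equiv`); `sum_siteLaplacian_relabel`,
  `sum_inner_siteGrad_relabel` (the lattice sums are relabelling-invariant), `relabel_mem_polyS`,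
  `relabel_mem_sdepOn`.
* **`luscher_series_relabel`** — relabelling a Lüscher series of `S` gives a Lüscher series of
  `relabel σ S`, with the same constants.
* **`luscher_series_symmetric`** — IF THE ACTION IS `σ`-INVARIANT, EVERY ORDER OF EVERY `C²` LÜSCHER
  SERIES IS `σ`-INVARIANT UP TO AN ADDITIVE CONSTANT on the product of unit spheres (uniqueness).
* **`exists_shared_local_luscher_series`** — WEIGHT SHARING: for a local polynomial action whose
  neighbourhood structure and parts are covariant under a transitive family of relabellings
  `τ_n` (`τ_n n₀ = n`, `N (τ_n a) = τ_n '' N a`, `s_n (x) = s_{n₀} (x ∘ τ_n)`)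
  and whose total action is `τ_n`-invariant, Lüscher's recursion is solved by
  `S̃⁽ᵏ⁾ = Σ_n X⁽ᵏ⁾ ∘ (· ∘ τ_n)` — THE SAME polynomial `X⁽ᵏ⁾ ∈ polySD (a(k+1)) (nball N (k+1) n₀)`
  translated to every site, its translate at `n` supported in `nball N (k+1) n`.

NOT CLAIMED: that a given lattice/coupling admits such a transitive covariant family (for the
periodic square lattice with translation-covariant links it does; not constructed here); anything at
`t > 0`; anything quantitative.
-/

noncomputable section

namespace Summit.Ventures.LatticeQCDFlow.Exactness

open Function Set NormedSpace InnerProductSpace Metric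
open scoped RealInnerProductSpace ContDiff Gradient

variable {Λ : Type*} {E : Type*} [NormedAddCommGroup E] [InnerProductSpace ℝ E]

/-! ## §1 Relabelling the sites -/

section Relabel

/-- **A functional read through a relabelling of the sites**: `relabel σ F x = F (x ∘ σ)`. -/
def relabel (σ : Λ ≃ Λ) (F : (Λ → E) → ℝ) : (Λ → E) → ℝ := fun x => F (x ∘ σ)

variable [DecidableEq Λ] (σ : Λ ≃ Λ)

omit [NormedAddCommGroup E] [InnerProductSpace ℝ E] in
/-- The site section of a relabelled functional is a site section of the original at the relabelled
configuration: `(F∘σ*)(x[k ← y]) = F((x∘σ)[σ⁻¹k ← y])`. -/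
theorem relabel_update (F : (Λ → E) → ℝ) (x : Λ → E) (k : Λ) (y : E) :
    relabel σ F (update x k y) = F (update (x ∘ σ) (σ.symm k) y) := by
  simp only [relabel, update_comp_equiv]

variable [FiniteDimensional ℝ E]

/-- **`∂̃_k (F∘σ*)(x) = ∂̃_{σ⁻¹ k} F (x ∘ σ)`.** -/
theorem siteGrad_relabel (F : (Λ → E) → ℝ) (x : Λ → E) (k : Λ) :
    siteGrad k (relabel σ F) x = siteGrad (σ.symm k) F (x ∘ σ) := by
  unfold siteGrad
  have e : (fun y : E => relabel σ F (update x k (normalize y))) =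
      fun y => F (update (x ∘ σ) (σ.symm k) (normalize y)) := funext fun y => relabel_update σ F x k _
  rw [e]
  simp only [comp_apply, Equiv.apply_symm_apply]

/-- **`∂̃_k·∂̃_k (F∘σ*)(x) = ∂̃_{σ⁻¹k}·∂̃_{σ⁻¹k} F (x ∘ σ)`.** -/
theorem siteLaplacian_relabel (F : (Λ → E) → ℝ) (x : Λ → E) (k : Λ) :
    siteLaplacian k (relabel σ F) x = siteLaplacian (σ.symm k) F (x ∘ σ) := by
  unfold siteLaplacian
  have e : (fun y : E => relabel σ F (update x k (normalize y))) =
      fun y => F (update (x ∘ σ) (σ.symm k) (normalize y)) := funext fun y => relabel_update σ F x k _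
  rw [e]
  simp only [comp_apply, Equiv.apply_symm_apply]

variable [Fintype Λ]

/-- **The lattice operator is relabelling-invariant**: `Σ_k ∂̃_k·∂̃_k (F∘σ*)(x) = Σ_k ∂̃_k·∂̃_k F (x∘σ)`. -/
theorem sum_siteLaplacian_relabel (F : (Λ → E) → ℝ) (x : Λ → E) :
    ∑ k, siteLaplacian k (relabel σ F) x = ∑ k, siteLaplacian k F (x ∘ σ) := by
  simp_rw [siteLaplacian_relabel]
  exact σ.symm.sum_comp (fun j => siteLaplacian j F (x ∘ σ))

/-- **The carré du champ sum is relabelling-invariant**: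
`Σ_k ⟪∂̃_k(S∘σ*), ∂̃_k(X∘σ*)⟫(x) = Σ_k ⟪∂̃_k S, ∂̃_k X⟫(x ∘ σ)`. -/
theorem sum_inner_siteGrad_relabel (S X : (Λ → E) → ℝ) (x : Λ → E) :
    ∑ k, ⟪siteGrad k (relabel σ S) x, siteGrad k (relabel σ X) x⟫ =
      ∑ k, ⟪siteGrad k S (x ∘ σ), siteGrad k X (x ∘ σ)⟫ := by
  simp_rw [siteGrad_relabel]
  exact σ.symm.sum_comp (fun j => ⟪siteGrad j S (x ∘ σ), siteGrad j X (x ∘ σ)⟫)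

omit [DecidableEq Λ] [Fintype Λ] in
/-- Relabelling a monomial gives a monomial (sites moved by `σ`). -/
theorem relabel_smonom {k : ℕ} (κs : Fin k → SiteCoord Λ E) :
    relabel σ (smonom κs) = smonom fun j => (σ (κs j).1, (κs j).2) := by
  funext x; simp [relabel, smonom, scoord]

omit [DecidableEq Λ] [Fintype Λ] in
/-- **`relabel σ` preserves `polyS N`.** -/
theorem relabel_mem_polyS {N : ℕ} {F : (Λ → E) → ℝ} (hF : F ∈ polyS Λ E N) :
    relabel σ F ∈ polyS Λ E N := by
  induction hF using Submodule.span_induction with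
  | mem f hf =>
      obtain ⟨⟨k, κs⟩, rfl⟩ := hf
      rw [relabel_smonom]
      exact smonom_mem (Nat.lt_succ_iff.1 k.2) _
  | zero => exact Submodule.zero_mem _
  | add f g _ _ hf hg => exact Submodule.add_mem _ hf hg
  | smul c f _ hf => exact Submodule.smul_mem _ c hf

omit [NormedAddCommGroup E] [InnerProductSpace ℝ E] [DecidableEq Λ] [FiniteDimensional ℝ E]
  [Fintype Λ] in
/-- **`relabel σ` moves supports**: `F ∈ sdepOn A ⇒ relabel σ F ∈ sdepOn (σ '' A)`. -/
theorem relabel_mem_sdepOn {A : Set Λ} {F : (Λ → E) → ℝ} (hF : F ∈ sdepOn A) :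
    relabel σ F ∈ sdepOn (E := E) (σ '' A) := fun _ _ hx =>
  hF fun m hm => hx (σ m) ⟨m, hm, rfl⟩

omit [DecidableEq Λ] [Fintype Λ] in
/-- `relabel σ` maps `polySD N A` to `polySD N (σ '' A)`. -/
theorem relabel_mem_polySD {N : ℕ} {A : Set Λ} {F : (Λ → E) → ℝ} (hF : F ∈ polySD Λ E N A) :
    relabel σ F ∈ polySD Λ E N (σ '' A) :=
  ⟨relabel_mem_polyS σ hF.1, relabel_mem_sdepOn σ hF.2⟩

omit [DecidableEq Λ] [FiniteDimensional ℝ E] in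
/-- Relabelled functionals are as smooth as the original. -/
theorem contDiff_relabel {n : ℕ∞ω} {F : (Λ → E) → ℝ} (hF : ContDiff ℝ n F) :
    ContDiff ℝ n (relabel σ F) :=
  hF.comp (contDiff_pi.2 fun i => contDiff_apply ℝ E (σ i))

omit [NormedAddCommGroup E] [InnerProductSpace ℝ E] [DecidableEq Λ] [FiniteDimensional ℝ E]
  [Fintype Λ] in
/-- A structure automorphism maps balls to balls: `N (τ a) = τ '' N a` for all `a` implies
`τ '' nball N r a = nball N r (τ a)`. -/
theorem image_nball {N : Λ → Set Λ} {τ : Λ ≃ Λ} (hN : ∀ a, N (τ a) = τ '' N a) (a : Λ) :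
    ∀ r, τ '' nball N r a = nball N r (τ a)
  | 0 => by
      show τ '' {a} = {τ a}
      exact image_singleton
  | r + 1 => by
      rw [nball_succ, nball_succ, image_union, image_iUnion₂, image_nball hN a r,
        ← image_nball hN a r, biUnion_image]
      congr 1
      exact iUnion₂_congr fun m _ => (hN m).symm

end Relabel

/-! ## §2 Relabelling a Lüscher series -/

section Series

variable [FiniteDimensional ℝ E] [Fintype Λ] [DecidableEq Λ] (σ : Λ ≃ Λ)

/-- **Relabelling a Lüscher series of `S` gives a Lüscher series of `relabel σ S`, with the same
constants** (the recursion is written on the product of unit spheres). -/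
theorem luscher_series_relabel {S : (Λ → E) → ℝ} {St : ℕ → (Λ → E) → ℝ} {c : ℕ → ℝ}
    (h0 : ∀ ξ : Λ → sphere (0 : E) 1,
      -∑ n, siteLaplacian n (St 0) (fun m => (ξ m : E)) = S (fun m => (ξ m : E)) + c 0)
    (hs : ∀ k, ∀ ξ : Λ → sphere (0 : E) 1,
      -∑ n, siteLaplacian n (St (k + 1)) (fun m => (ξ m : E)) =
        -(∑ n, ⟪siteGrad n S (fun m => (ξ m : E)), siteGrad n (St k) (fun m => (ξ m : E))⟫) +
          c (k + 1)) :
    (∀ ξ : Λ → sphere (0 : E) 1,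
      -∑ n, siteLaplacian n (relabel σ (St 0)) (fun m => (ξ m : E)) =
        relabel σ S (fun m => (ξ m : E)) + c 0) ∧
    (∀ k, ∀ ξ : Λ → sphere (0 : E) 1,
      -∑ n, siteLaplacian n (relabel σ (St (k + 1))) (fun m => (ξ m : E)) =
        -(∑ n, ⟪siteGrad n (relabel σ S) (fun m => (ξ m : E)),
            siteGrad n (relabel σ (St k)) (fun m => (ξ m : E))⟫) + c (k + 1)) := by
  refine ⟨fun ξ => ?_, fun k ξ => ?_⟩
  · rw [sum_siteLaplacian_relabel]
    exact h0 (ξ ∘ σ)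
  · rw [sum_siteLaplacian_relabel, sum_inner_siteGrad_relabel]
    exact hs k (ξ ∘ σ)

variable [MeasurableSpace E] [BorelSpace E]

/-- **EVERY ORDER OF THE FLOW ACTION INHERITS THE LATTICE SYMMETRIES OF THE ACTION, UP TO
CONSTANTS.**  If `S` is invariant under the relabelling `σ` (`S (x ∘ σ) = S x`) and `(S̃⁽ᵏ⁾, ċ_k)` is
any `C²` solution of Lüscher's recursion for `S` on the product of unit spheres, then for every `k`
there is a constant `d_k` with `S̃⁽ᵏ⁾(ξ ∘ σ) = S̃⁽ᵏ⁾(ξ) + d_k` for all sphere configurations `ξ`. -/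
theorem luscher_series_symmetric [Nonempty Λ] (h2 : 2 ≤ Module.finrank ℝ E) {S : (Λ → E) → ℝ}
    (hS : relabel σ S = S) {St : ℕ → (Λ → E) → ℝ} {c : ℕ → ℝ} (hSt : ∀ k, ContDiff ℝ 2 (St k))
    (h0 : ∀ ξ : Λ → sphere (0 : E) 1,
      -∑ n, siteLaplacian n (St 0) (fun m => (ξ m : E)) = S (fun m => (ξ m : E)) + c 0)
    (hs : ∀ k, ∀ ξ : Λ → sphere (0 : E) 1,
      -∑ n, siteLaplacian n (St (k + 1)) (fun m => (ξ m : E)) =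
        -(∑ n, ⟪siteGrad n S (fun m => (ξ m : E)), siteGrad n (St k) (fun m => (ξ m : E))⟫) +
          c (k + 1)) (k : ℕ) :
    ∃ d : ℝ, ∀ ξ : Λ → sphere (0 : E) 1,
      St k ((fun m => (ξ m : E)) ∘ σ) = St k (fun m => (ξ m : E)) + d := by
  obtain ⟨h0', hs'⟩ := luscher_series_relabel σ h0 hs
  rw [hS] at h0' hs'
  obtain ⟨-, d, hd⟩ := luscher_series_unique h2 (fun k => contDiff_relabel σ (hSt k)) hSt h0' h0
    hs' hs k
  exact ⟨d, hd⟩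

end Series

/-! ## §3 Weight sharing: the local terms as translates of one polynomial -/

section WeightSharing

variable [FiniteDimensional ℝ E] [MeasurableSpace E] [BorelSpace E] [Fintype Λ] [DecidableEq Λ]
  [Nonempty Λ]

/-- **WEIGHT SHARING.**  Let `S = Σ_n s_n` be a local polynomial action with a transitive family of
relabellings `τ_n` (`τ_n n₀ = n`) that are automorphisms of the neighbourhood structure
(`N (τ_n a) = τ_n '' N a`), under which the parts are translates of one part (`s_n = s_{n₀} ∘ τ_n^*`)
and the total action is invariant.  Then Lüscher's recursion on the product of unit spheres
(`dim E ≥ 2`) is solved by `S̃⁽ᵏ⁾ = Σ_n X⁽ᵏ⁾ ∘ (· ∘ τ_n)` with ONE lattice polynomial `X⁽ᵏ⁾` of degree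
`≤ a(k+1)` supported in `nball N (k+1) n₀` per order, whose translate to `n` is supported in
`nball N (k+1) n`. -/
theorem exists_shared_local_luscher_series (h2 : 2 ≤ Module.finrank ℝ E) (D : LocalAction Λ E)
    (n₀ : Λ) (τ : Λ → Λ ≃ Λ) (hτ : ∀ n, τ n n₀ = n) (hN : ∀ n a, D.N (τ n a) = τ n '' D.N a)
    (hpart : ∀ n, D.part n = relabel (τ n) (D.part n₀))
    (hS : ∀ n, relabel (τ n) D.action = D.action) :
    ∃ (X : ℕ → (Λ → E) → ℝ) (c : ℕ → ℝ),
      (∀ k, X k ∈ polySD Λ E (D.deg * (k + 1)) (nball D.N (k + 1) n₀)) ∧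
      (∀ k n, relabel (τ n) (X k) ∈ polySD Λ E (D.deg * (k + 1)) (nball D.N (k + 1) n)) ∧
      (∀ ξ : Λ → sphere (0 : E) 1,
        -∑ j, siteLaplacian j (fun x => ∑ n, relabel (τ n) (X 0) x) (fun m => (ξ m : E)) =
          D.action (fun m => (ξ m : E)) + c 0) ∧
      (∀ k, ∀ ξ : Λ → sphere (0 : E) 1,
        -∑ j, siteLaplacian j (fun x => ∑ n, relabel (τ n) (X (k + 1)) x) (fun m => (ξ m : E)) =
          -(∑ j, ⟪siteGrad j D.action (fun m => (ξ m : E)),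
              siteGrad j (fun x => ∑ n, relabel (τ n) (X k) x) (fun m => (ξ m : E))⟫) +
            c (k + 1)) := by
  -- the anchored terms at n₀ and their constants
  set X : ℕ → (Λ → E) → ℝ := fun k => localTerm h2 D k n₀ with hX
  have hXmem : ∀ k, X k ∈ polySD Λ E (D.deg * (k + 1)) (nball D.N (k + 1) n₀) :=
    fun k => localTerm_mem h2 D k n₀
  have hYmem : ∀ k n, relabel (τ n) (X k) ∈ polySD Λ E (D.deg * (k + 1)) (nball D.N (k + 1) n) := by
    intro k n
    have h := relabel_mem_polySD (τ n) (hXmem k)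
    rwa [image_nball (hN n) n₀ (k + 1), hτ n] at h
  let c0 : ℝ := Classical.choose (localTerm_zero_spec h2 D n₀)
  have hc0 := Classical.choose_spec (localTerm_zero_spec h2 D n₀)
  let cs : ℕ → ℝ := fun k => Classical.choose (localTerm_succ_spec h2 D k n₀)
  have hcs := fun k => Classical.choose_spec (localTerm_succ_spec h2 D k n₀)
  refine ⟨X, fun k => Nat.casesOn k (Fintype.card Λ * c0) fun j => Fintype.card Λ * cs j, hXmem,
    hYmem, fun ξ => ?_, fun k ξ => ?_⟩
  · -- order 0: each translate solves −Σ∂̃² Y_n = s_n + c0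
    have hY : ∀ n, -∑ j, siteLaplacian j (relabel (τ n) (X 0)) (fun m => (ξ m : E)) =
        D.part n (fun m => (ξ m : E)) + c0 := fun n => by
      rw [sum_siteLaplacian_relabel, hpart n]
      exact hc0 (ξ ∘ τ n)
    calc -∑ j, siteLaplacian j (fun x => ∑ n, relabel (τ n) (X 0) x) (fun m => (ξ m : E))
        = ∑ n, -∑ j, siteLaplacian j (relabel (τ n) (X 0)) (fun m => (ξ m : E)) :=
          neg_sum_siteLaplacian_sum Finset.univ (fun n _ => (hYmem 0 n).1) ξ
      _ = ∑ n, (D.part n (fun m => (ξ m : E)) + c0) := Finset.sum_congr rfl fun n _ => hY n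
      _ = D.action (fun m => (ξ m : E)) + Fintype.card Λ * c0 := by
          rw [Finset.sum_add_distrib, Finset.sum_const, Finset.card_univ, nsmul_eq_mul]; rfl
  · -- order k+1: each translate solves −Σ∂̃² Y_n = −Σ⟪∂̃S, ∂̃Y_n⟫ + cs k
    have hY : ∀ n, -∑ j, siteLaplacian j (relabel (τ n) (X (k + 1))) (fun m => (ξ m : E)) =
        -(∑ j, ⟪siteGrad j D.action (fun m => (ξ m : E)),
            siteGrad j (relabel (τ n) (X k)) (fun m => (ξ m : E))⟫) + cs k := fun n => by
      rw [sum_siteLaplacian_relabel]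
      conv_rhs => rw [← hS n]
      rw [sum_inner_siteGrad_relabel, sum_inner_siteGrad_eq_latticeCarre
        (contDiff_of_mem_polyS D.action_mem) (contDiff_of_mem_polyS (hXmem k).1) fun m => by simp]
      exact hcs k (ξ ∘ τ n)
    have hG : ∀ j, siteGrad j (fun x => ∑ n, relabel (τ n) (X k) x) (fun m => (ξ m : E)) =
        ∑ n, siteGrad j (relabel (τ n) (X k)) (fun m => (ξ m : E)) := fun j =>
      siteGrad_sum Finset.univ (fun n _ => (hYmem k n).1) ξ j
    calc -∑ j, siteLaplacian j (fun x => ∑ n, relabel (τ n) (X (k + 1)) x) (fun m => (ξ m : E))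
        = ∑ n, -∑ j, siteLaplacian j (relabel (τ n) (X (k + 1))) (fun m => (ξ m : E)) :=
          neg_sum_siteLaplacian_sum Finset.univ (fun n _ => (hYmem (k + 1) n).1) ξ
      _ = ∑ n, (-(∑ j, ⟪siteGrad j D.action (fun m => (ξ m : E)),
            siteGrad j (relabel (τ n) (X k)) (fun m => (ξ m : E))⟫) + cs k) :=
          Finset.sum_congr rfl fun n _ => hY n
      _ = -(∑ j, ∑ n, ⟪siteGrad j D.action (fun m => (ξ m : E)),
            siteGrad j (relabel (τ n) (X k)) (fun m => (ξ m : E))⟫) + Fintype.card Λ * cs k := by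
          rw [Finset.sum_add_distrib, Finset.sum_neg_distrib, Finset.sum_comm, Finset.sum_const,
            Finset.card_univ, nsmul_eq_mul]
      _ = -(∑ j, ⟪siteGrad j D.action (fun m => (ξ m : E)),
            siteGrad j (fun x => ∑ n, relabel (τ n) (X k) x) (fun m => (ξ m : E))⟫) +
              Fintype.card Λ * cs k := by
          congr 2
          exact Finset.sum_congr rfl fun j _ => by rw [hG j, inner_sum]

end WeightSharing


end Summit.Ventures.LatticeQCDFlow.Exactness

end
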